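import Summits.HodgeConjecture.HodgeConjecture.Theorems.MarkmanPartnerTransportIsometrySpannedThirdKappaClasses
import Summits.HodgeConjecture.HodgeConjecture.Theorems.MarkmanPartnerTransportPartnerExistenceBBFPositivity
import Summits.HodgeConjecture.HodgeConjecture.Theorems.Ring2AbelianAllAndreCorrespondenceCategory
import Literature.AlgebraicGeometry.Hyperkaehler.K3HilbertTypeLefschetzStandard
import Literature.AlgebraicGeometry.Hyperkaehler.K3HilbertSquareTypeCohomology
import Literature.AlgebraicGeometry.HodgeTheory.BettiKunnethPieceCorrespondenceActionInjective
import Literature.AlgebraicGeometry.HodgeTheory.KunnethComponentsDiagonalAction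
import Literature.AlgebraicGeometry.HodgeTheory.KunnethComponentsDiagonalTranspose
import Literature.AlgebraicGeometry.HodgeTheory.KunnethComponentsDiagonalAlgebraicPart
import Literature.AlgebraicGeometry.HodgeTheory.AbsoluteHodgeClassesKunnethComponentsExist
import Literature.AlgebraicGeometry.HodgeTheory.HomologicalNumericalEquivalenceOfLefschetzStandard
import Literature.AlgebraicGeometry.HodgeTheory.AlgebraicClassesExteriorProduct
import Literature.AlgebraicGeometry.HodgeTheory.AlgebraicClassesLiftAlongCorrespondences
import Literature.AlgebraicGeometry.HodgeTheory.AlgebraicClassesPullback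
import Literature.AlgebraicGeometry.HodgeTheory.HypersurfaceLefschetz
import HarnessLib

/-!
# Route MarkmanPartnerTransport · support #3 `IsometrySpannedThird` — the INVERSE BEAUVILLE–BOGOMOLOV CLASS
# `Q_X = Σᵢⱼ (G⁻¹)ᵢⱼ · pr₁^*(φ⁻¹eᵢ) ∪ pr₂^*(φ⁻¹eⱼ) ∈ H⁴(X × X)` IS ALGEBRAIC, from `B(X)` (Charles–Markman 2013)

The tree's `isometrySpannedThird_of_kappaClasses` gives the item from the algebraicity of the classes
`κ_g = Σᵢⱼ (G⁻¹)ᵢⱼ · φ⁻¹eᵢ ∪ g(φ⁻¹eⱼ)`, and `κ_g = pr_{1*}(Q_X ∪ Z_g)` (`Z_g` Markman's class of the isometry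
`g`); this file PROVES that `Q_X` is algebraic, granted `B(X)` (`CharlesMarkman2013_lefschetzStandard_K3HilbertType`)
and `b₃(X) = 0` (`VerbitskyGuan_cohomology_K3HilbertSquareType`).
* §1 (any smooth projective `W`, `X`): the Künneth components in `H^{2e}(W) ⊗ H⁰(X)` and `H⁰(W) ⊗ H^{2e}(X)` of
  an algebraic `γ ∈ Nᵉ H^{2e}(W × X)` are algebraic — the former is `pr_W^* γ_*(u₀) ∪ pr_X^* 1` for a top class
  `u₀` (a class of ONE Künneth piece is determined by its action, Voisin I Lemma 11.41 =
  `eq_of_mem_kunnethPiece_of_corrAction_eq`; `γ_*` preserves algebraic classes by Voisin II Prop. 9.20 — the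
  hypothesis `hcup`, DISCHARGED in the tree by `Theorems.Voisin2003_cupProduct_algebraicClasses_holds`), the
  latter by the exchange of factors.
* §2: for the Kähler class `h` of a Kähler–rational datum (`q(h,h) > 0`), `B(X)` in bidegree `(6, 2)` says that
  `θ = (L_h²)⁻¹ : H⁶ → H²` is `[γ]_*`, `γ ∈ N²H⁴(X × X)` algebraic; by §1 and `b₃ = 0` its `H² ⊗ H²`-component
  `γ₂₂` is algebraic and acts as `θ`; and **`Q_X = λq(h,h)·γ₂₂ + (2/(3q(h,h)))·pr₁^*h ∪ pr₂^*h`**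
  (`pr_{1*}pr₂^*P = λ·1`), both sides lying in `H² ⊗ H²` and acting alike on `H⁶ = L_h² H²`: by polarised
  Fujiki `h²aw = (q(h,h)q(a,w) + 2q(h,a)q(h,w))P` and `Σᵢⱼ (G⁻¹)ᵢⱼ q(u,eⱼ)eᵢ = u`, `Q_X` sends `L_h²a` to
  `λ(q(h,h)a + 2q(h,a)h)`, `pr₁^*h ∪ pr₂^*h` to `3λq(h,h)q(h,a)h`, `γ₂₂` to `a` (Sherman–Morrison on actions).
* `isometrySpannedThird_of_kappaClasses_of_qInv`: the item BY NAME from {Verbitsky–Guan, O'Grady, Voisin cup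
  (a tree theorem), Charles–Markman} and the implication «`Q_X` algebraic ⇒ `κ_g` algebraic» (W-QX1, Markman 2024),
  a hypothesis here.

CONDITIONAL; no definition, no sorry, no new fact; `MarkedK3Sq[…]`, `Kappa[…]` VERBATIM from
`…IsometrySpannedThirdKappaClasses`, `QInv[X, φ]` VERBATIM the body of `qInvClass` of the cell's Sketch P1AH-QX.
Nothing here says HC is proved. Cell hodge-nonav, seat 19716-p2 (g2), ask W-QX2 of p1 (g35). References: Charles–Markman,
Compos. Math. 149 (2013) Thm. 1.1; Kleiman 1968 §2; Voisin, *Hodge Theory I* Lemma 11.41, *II* Prop. 9.20; O'Grady 2008.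
-/

noncomputable section

set_option linter.dupNamespace false

open Module CategoryTheory MonoidalCategory CartesianMonoidalCategory
open Literature.AlgebraicTopology.SingularHomology Literature.Geometry.Kaehler
open Literature.AlgebraicGeometry Literature.AlgebraicGeometry.Motives Literature.AlgebraicGeometry.HodgeTheory
open Literature.AlgebraicGeometry.Hyperkaehler
open Summit.HodgeConjecture.HodgeConjecture.Ring2.AbelianAll

namespace Summit.HodgeConjecture.HodgeConjecture.Theorems.MarkmanPartnerTransport.PartnerLattice

/-! ### §1 The extreme Künneth components of an algebraic class are algebraic -/

section Kunneth

variable {m n : ℕ} {W X : SchemeOver ℂ}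

/-- Transport of membership in a Künneth piece along a re-spelling of the bidegree. [folklore] -/
theorem mem_kunnethPiece_congr {i j i' j' k : ℕ} (h : i + j = k) (h' : i' + j' = k) (hi : i = i')
    (hj : j = j') {z : complexBetti (W ⊗ X) k} (hz : z ∈ kunnethPiece W X h) :
    z ∈ kunnethPiece W X h' := by
  subst hi hj
  exact hz

/-- **The Künneth component in `H^{2e}(W) ⊗ H⁰(X)` of an algebraic `γ ∈ Nᵉ H^{2e}((W ⊗ X)(ℂ); ℂ)` is
algebraic**: it is `pr_W^* γ_*(u₀) ∪ pr_X^* 1`, `u₀` a top class of `X` (`γ_*(u₀) ∈ Nᵉ H^{2e}(W)`; a class of the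
piece `H^{2e}(W) ⊗ H⁰(X)` is determined by its action on `H^{2n}(X)`, Voisin I Lemma 11.41).
[cite: VoisinHodgeI2002, §11.3.3 Lemma 11.41 and p. 286] [cite: VoisinHodgeII2003, §9.2.4 Prop. 9.20] -/
theorem kunnethComponent_zero_mem_algebraicClasses (hcup : Voisin2003_cupProduct_algebraicClasses)
    (hW : IsSmoothProjective m W) (hX : IsSmoothProjective n X) {e : ℕ} {γ : complexBetti (W ⊗ X) (2 * e)}
    (hγ : γ ∈ algebraicClasses (W ⊗ X) e) {ρ : Fin (2 * e + 1) → complexBetti (W ⊗ X) (2 * e)}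
    (hρ : ∀ d : Fin (2 * e + 1), ρ d ∈ kunnethPiece W X (show (2 * e - (d : ℕ)) + d = 2 * e by omega))
    (hsum : ∑ d, ρ d = γ) :
    ρ 0 ∈ algebraicClasses (W ⊗ X) e := by
  set μ : OrientationFamily := complexOrientationFamily with hμdef
  have hab : 2 * n + 2 * e = 2 * e + 2 * n := by omega
  have hij : 2 * e + 0 = 2 * e := rfl
  have haj : 2 * n + 0 = 2 * n := rfl
  have hρ0 : ρ 0 ∈ kunnethPiece W X hij := mem_kunnethPiece_congr _ hij (by simp) (by simp) (hρ 0)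
  -- the action of `γ` on `H^{2n}(X)` is that of `ρ 0`
  have hact : corrAction μ hW hX hab γ = corrAction μ hW hX hab (ρ 0) := by
    rw [← hsum]
    exact corrAction_sum_kunnethComponents_of_add_eq μ hW hX hρ hab 0 (by simp)
  by_cases htriv : ∀ u : complexBetti X (2 * n), u = 0
  · -- degenerate case (harmless): `ρ 0` acts by zero, hence vanishes
    have h0 : corrAction μ hW hX hab (ρ 0) = 0 :=
      LinearMap.ext fun u ↦ by rw [htriv u, map_zero, LinearMap.zero_apply]
    rw [corrAction_injOn_kunnethPiece μ hW hX hij haj hab hρ0 h0]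
    exact Submodule.zero_mem _
  push Not at htriv
  obtain ⟨u₁, hu₁⟩ := htriv
  -- `pr_{W*} pr_X^* u₁ = t • 1` with `t ≠ 0`; normalise to `u₀` with `pr_{W*} pr_X^* u₀ = 1`
  obtain ⟨t, ht⟩ := exists_eq_smul_one μ hW (complexGysin μ (hW.tensor_holds hX) hW (fst W X)
    (show 2 * n + 2 * m = 0 + 2 * (m + n) by omega) (complexBetti.map (snd W X) (2 * n) u₁))
  have ht0 : t ≠ 0 := fun h ↦
    hu₁ (eq_zero_of_complexGysin_fst_map_snd_eq_zero μ hW hX (by rw [ht, h, zero_smul]))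
  set u₀ : complexBetti X (2 * n) := t⁻¹ • u₁ with hu₀def
  have hu₀ : u₀ ≠ 0 := smul_ne_zero (inv_ne_zero ht0) hu₁
  have ht₀ : complexGysin μ (hW.tensor_holds hX) hW (fst W X) (show 2 * n + 2 * m = 0 + 2 * (m + n) by omega)
      (complexBetti.map (snd W X) (2 * n) u₀) = singularCohomology.one ℂ (ComplexPoints W) := by
    rw [hu₀def, map_smul, map_smul, ht, smul_smul, inv_mul_cancel₀ ht0, one_smul]
  -- `β = γ_*(u₀)` is algebraic (`γ_*` preserves algebraic classes; top classes are algebraic)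
  set β : complexBetti W (2 * e) := corrAction μ hW hX hab γ u₀ with hβdef
  have hβ : β ∈ algebraicClasses W e :=
    corrAction_mem_algebraicClasses_of_cupProduct' μ hW hX hab
      (fun x y hx hy ↦ hcup (hW.tensor_holds hX) hx hy) hγ
      (by rw [algebraicClasses_eq_top_of_eq_zero_or_le hX (Or.inr le_rfl)]; exact Submodule.mem_top)
  have h1 : singularCohomology.one ℂ (ComplexPoints X) ∈ algebraicClasses X 0 := by
    rw [algebraicClasses_zero]; exact Submodule.mem_top
  have hπ₀alg := cupProduct_map_fst_map_snd_mem_algebraicClasses hW hX hβ h1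
  -- `ρ 0 = pr_W^* β ∪ pr_X^* 1`: both lie in `H^{2e}(W) ⊗ H⁰(X)` and act alike on `H^{2n}(X) = ℂ u₀`
  suffices heq : ρ 0 = cupProduct hij (complexBetti.map (fst W X) (2 * e) β)
      (complexBetti.map (snd W X) 0 (singularCohomology.one ℂ (ComplexPoints X))) by
    rw [heq]; simpa using hπ₀alg
  refine eq_of_mem_kunnethPiece_of_corrAction_eq μ hW hX hij haj hab hρ0
    (cupProduct_fst_snd_mem_kunnethPiece hij _ _) (hact ▸ LinearMap.ext fun u ↦ ?_)
  obtain ⟨s, rfl⟩ := exists_eq_smul_of_top μ hX hu₀ u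
  rw [map_smul, corrAction_cupProduct_fst_snd_eq μ hW hX hij haj hab, cupProduct_one, map_smul,
    map_smul, map_smul, ht₀, map_smul, cupProduct_one, hβdef, hu₀def, map_smul,
    show 2 * n * (2 * e) = 2 * (n * (2 * e)) by ring, pow_mul, neg_one_sq, one_pow, one_smul]

/-- The exchange of factors `σ = (pr₂, pr₁) : X ⊗ W ⟶ W ⊗ X` is an isomorphism. [folklore] -/
theorem isIso_swap (W X : SchemeOver ℂ) : IsIso (lift (snd X W) (fst X W) : X ⊗ W ⟶ W ⊗ X) :=
  ⟨⟨lift (snd W X) (fst W X), swap_comp_swap X W, swap_comp_swap W X⟩⟩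

/-- **The Künneth component in `H⁰(W) ⊗ H^{2e}(X)` of an algebraic `γ ∈ Nᵉ H^{2e}((W ⊗ X)(ℂ); ℂ)` is
algebraic** (the previous statement for `σ^* γ` on `X ⊗ W`, whose Künneth components are the transposed ones).
[cite: VoisinHodgeI2002, §11.3.3 Lemma 11.41 and Thm. 11.38] [cite: Kahn2020, §3.5.3 (3.5.4)] -/
theorem kunnethComponent_last_mem_algebraicClasses (hcup : Voisin2003_cupProduct_algebraicClasses)
    (hW : IsSmoothProjective m W) (hX : IsSmoothProjective n X) {e : ℕ} {γ : complexBetti (W ⊗ X) (2 * e)}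
    (hγ : γ ∈ algebraicClasses (W ⊗ X) e) {ρ : Fin (2 * e + 1) → complexBetti (W ⊗ X) (2 * e)}
    (hρ : ∀ d : Fin (2 * e + 1), ρ d ∈ kunnethPiece W X (show (2 * e - (d : ℕ)) + d = 2 * e by omega))
    (hsum : ∑ d, ρ d = γ) :
    ρ (Fin.last (2 * e)) ∈ algebraicClasses (W ⊗ X) e := by
  -- the transposed family on `X ⊗ W`
  set ρ' : Fin (2 * e + 1) → complexBetti (X ⊗ W) (2 * e) :=
    fun d ↦ complexBetti.map (lift (snd X W) (fst X W)) (2 * e) (ρ (Fin.rev d)) with hρ'def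
  have hρ' : ∀ d : Fin (2 * e + 1), ρ' d ∈ kunnethPiece X W (show (2 * e - (d : ℕ)) + d = 2 * e by omega) :=
    fun d ↦ map_swap_rev_mem_kunnethPiece (2 * e) hρ d
  have hsum' : ∑ d, ρ' d = complexBetti.map (lift (snd X W) (fst X W)) (2 * e) γ := by
    rw [← hsum, map_sum]
    exact Fintype.sum_equiv Fin.revPerm _ _ fun _ ↦ rfl
  haveI := isIso_swap W X
  haveI := isIso_swap X W
  have hγ' : complexBetti.map (lift (snd X W) (fst X W)) (2 * e) γ ∈ algebraicClasses (X ⊗ W) e :=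
    map_mem_algebraicClasses_of_isIso _ hγ
  have h0 : ρ' 0 ∈ algebraicClasses (X ⊗ W) e :=
    kunnethComponent_zero_mem_algebraicClasses hcup hX hW hγ' hρ' hsum'
  have hrev : ρ (Fin.last (2 * e)) =
      complexBetti.map (lift (snd W X) (fst W X)) (2 * e) (ρ' 0) := by
    rw [hρ'def]
    simp only [Fin.rev_zero, complexBetti_map_swap_map_swap]
  rw [hrev]
  exact map_mem_algebraicClasses_of_isIso _ h0

end Kunneth

/-! ### §2 Marked `K3^{[2]}`-type fourfolds: the inverse Beauville–Bogomolov class is algebraic -/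

section Marked

/-- `MarkedK3Sq[X, φ, P, z]`: VERBATIM the `let MarkedK3Sq := …` binder of the route declarations of
MarkmanPartnerTransport (clauses (m1)–(m6)). Local notation only. -/
local notation3 (prettyPrint := false) "MarkedK3Sq[" X ", " φ ", " P ", " z "]" =>
  (((IsIntegralClass P ∧ ∀ Q : complexBetti X (2 * 4), IsIntegralClass Q → ∃ n : ℤ, Q = n • P) ∧
    (∀ c : complexBetti X 2, IsIntegralClass c ↔ ∃ v : K3HilbertIndex → ℤ, φ c = fun i => (v i : ℂ)) ∧
    (∀ a : complexBetti X 2, cupPowTwo a 4 = ((3 : ℂ) * (k3HilbertForm 2 (φ a) (φ a)) ^ 2) • P) ∧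
    (IsOfHodgeType 4 X 2 2 0 (LinearEquiv.symm φ z) ∧
      ∀ τ : complexBetti X 2, IsOfHodgeType 4 X 2 2 0 τ → ∃ t : ℂ, τ = t • LinearEquiv.symm φ z) ∧
    (∀ c : complexBetti X 2, IsOfHodgeType 4 X 2 1 1 c ↔
      (k3HilbertForm 2 (φ c) z = 0 ∧ k3HilbertForm 2 (φ c) (star z) = 0)) ∧
    (k3HilbertForm 2 z z = 0 ∧ 0 < (k3HilbertForm 2 (star z) z).re)))

/-- `QInv[X, φ]`: the inverse Beauville–Bogomolov class `Q_X = Σᵢⱼ (G⁻¹)ᵢⱼ · pr₁^*(φ⁻¹eᵢ) ∪ pr₂^*(φ⁻¹eⱼ)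
∈ H⁴((X ⊗ X)(ℂ); ℂ)` (`G = k3HilbertGram 2`, `det G = 2`; VERBATIM the body of `qInvClass` of the cell's
Sketch P1AH-QX). Local notation only. -/
local notation3 (prettyPrint := false) "QInv[" X ", " φ "]" =>
  ∑ i : K3HilbertIndex, ∑ j : K3HilbertIndex,
    (((k3HilbertGram 2).map (Int.cast : ℤ → ℂ))⁻¹ i j) • cupProduct (rfl : 2 + 2 = 2 * 2)
      (complexBetti.map (fst X X) 2 ((LinearEquiv.symm φ) (Pi.single i 1)))
      (complexBetti.map (snd X X) 2 ((LinearEquiv.symm φ) (Pi.single j 1)))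

variable {X : SchemeOver ℂ} {φ : complexBetti X 2 ≃ₗ[ℂ] (K3HilbertIndex → ℂ)} {P : complexBetti X (2 * 4)}
  {z : K3HilbertIndex → ℂ}

/-- **Contraction with the inverse Gram matrix**: `Σᵢⱼ (G⁻¹)ᵢⱼ q(φu, eⱼ) · φ⁻¹eᵢ = u` for every
`u ∈ H²(X(ℂ); ℂ)` (`G⁻¹ G = 1`, `det G = 2 ≠ 0`, and `u = Σᵢ (φu)ᵢ · φ⁻¹eᵢ`).
[cite: OGrady2008NumericalK3Square, §2.1 (2.1.2)] -/
theorem sum_gramInv_mul_k3HilbertForm_smul (φ : complexBetti X 2 ≃ₗ[ℂ] (K3HilbertIndex → ℂ))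
    (u : complexBetti X 2) :
    ∑ i, ∑ j, (((k3HilbertGram 2).map (Int.cast : ℤ → ℂ))⁻¹ i j *
        k3HilbertForm 2 (φ u) (Pi.single j 1)) • (LinearEquiv.symm φ) (Pi.single i 1) = u := by
  classical
  have hdet : IsUnit ((k3HilbertGram 2).map (Int.cast : ℤ → ℂ)).det := by
    rw [← Int.cast_det, k3HilbertGram_two_det, isUnit_iff_ne_zero]; norm_num
  conv_rhs => rw [eq_sum_smul_symm_single φ u]
  refine Finset.sum_congr rfl fun i _ ↦ ?_
  rw [← Finset.sum_smul]
  congr 1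
  have hq : ∀ j, k3HilbertForm 2 (φ u) (Pi.single j 1) =
      (((k3HilbertGram 2).map (Int.cast : ℤ → ℂ)).mulVec (φ u)) j := fun j ↦ by
    rw [k3HilbertForm_comm, k3HilbertForm_single_left]
  simp_rw [hq]
  have h2 : ∑ j, ((k3HilbertGram 2).map (Int.cast : ℤ → ℂ))⁻¹ i j *
      (((k3HilbertGram 2).map (Int.cast : ℤ → ℂ)).mulVec (φ u)) j =
      ((((k3HilbertGram 2).map (Int.cast : ℤ → ℂ))⁻¹).mulVec
        ((((k3HilbertGram 2).map (Int.cast : ℤ → ℂ))).mulVec (φ u))) i := rfl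
  rw [h2, Matrix.mulVec_mulVec, Matrix.nonsing_inv_mul _ hdet, Matrix.one_mulVec]

/-- **The action of `pr₁^*y ∪ pr₂^*w` (`y, w ∈ H²`) on `L_h² a ∈ H⁶` of a marked `K3^{[2]}`-type fourfold**:
`[pr₁^*y ∪ pr₂^*w]_*(h ∪ h ∪ a) = λ·(q(h,h)q(a,w) + q(h,a)q(h,w) + q(h,w)q(h,a))·y`, `pr_{1*}pr₂^* P = λ·1`
(projection formula and polarised Fujiki). [cite: VoisinHodgeI2002, §11.3.3 p. 286]
[cite: OGrady2008NumericalK3Square, §2.2 Remark 2.1] -/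
theorem corrAction_cross_lefschetzPow_two (μ : OrientationFamily) (hX : IsSmoothProjective 4 X)
    {P : complexBetti X (2 * (2 * 2))} (hMK : IsMarkedK3Hilb 2 X φ P)
    (hab : 2 + 2 * 2 + 2 * 2 = 2 + 2 * 4) {lam : ℂ}
    (hlam : complexGysin μ (hX.tensor_holds hX) hX (fst X X) (show 2 * 4 + 2 * 4 = 0 + 2 * (4 + 4) by omega)
      (complexBetti.map (snd X X) (2 * 4) P) = lam • singularCohomology.one ℂ (ComplexPoints X))
    (h y w a : complexBetti X 2) :
    corrAction μ hX hX hab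
        (cupProduct (rfl : 2 + 2 = 2 * 2) (complexBetti.map (fst X X) 2 y) (complexBetti.map (snd X X) 2 w))
        (lefschetzPow h 2 2 a) =
      (lam * (k3HilbertForm 2 (φ h) (φ h) * k3HilbertForm 2 (φ a) (φ w) +
        k3HilbertForm 2 (φ h) (φ a) * k3HilbertForm 2 (φ h) (φ w) +
        k3HilbertForm 2 (φ h) (φ w) * k3HilbertForm 2 (φ h) (φ a))) • y := by
  rw [corrAction_cupProduct_fst_snd_eq μ hX hX (rfl : 2 + 2 = 2 * 2)
      (show 2 + 2 * 2 + 2 = 2 * 4 by norm_num) hab,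
    BBFPositivity.cupProduct_lefschetzPow_two_eq_cupFour, cupFour_eq_of_isMarkedK3Hilb hMK, map_smul, map_smul, hlam,
    smul_smul, map_smul, cupProduct_one, smul_smul]
  rw [show ((-1 : ℂ) ^ ((2 + 2 * 2) * 2)) = 1 by norm_num, one_mul, mul_comm]

/-- **W-QX2: the inverse Beauville–Bogomolov class `Q_X ∈ H⁴(X × X)` of a marked smooth projective
`K3^{[2]}`-type fourfold is ALGEBRAIC, granted `B(X)` (Charles–Markman 2013) and `b₃(X) = 0` (Verbitsky–Guan).**
`B(X)` at `(6, 2)` gives an algebraic `γ ∈ N²H⁴(X × X)` acting on `H⁶` as `θ = (L_h²)⁻¹`; its `H² ⊗ H²`-component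
`γ₂₂` is algebraic (§1, `b₃ = 0`) and acts as `θ`; and `Q_X = λq(h,h)·γ₂₂ + (2/(3q(h,h)))·pr₁^*h ∪ pr₂^*h`, both
sides lying in `H² ⊗ H²` and acting alike on `H⁶ = L_h² H²` (module docstring).
[cite: CharlesMarkman2013, Thm. 1.1 (§1)] [cite: Kleiman1968AlgebraicCycles, §2]
[cite: VoisinHodgeI2002, §11.3.3 Lemma 11.41] [cite: OGrady2008NumericalK3Square, §2.2 Remark 2.1] -/
theorem qInv_mem_algebraicClasses (hV : VerbitskyGuan_cohomology_K3HilbertSquareType)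
    (hcup : Voisin2003_cupProduct_algebraicClasses) (hB : CharlesMarkman2013_lefschetzStandard_K3HilbertType)
    (hX : IsSmoothProjective 4 X) (hK : IsOfK3HilbertSquareType X) (hM : MarkedK3Sq[X, φ, P, z]) :
    QInv[X, φ] ∈ algebraicClasses (X ⊗ X) 2 := by
  classical
  set μ : OrientationFamily := complexOrientationFamily with hμdef
  have hMK : IsMarkedK3Hilb 2 X φ P := BBFPositivity.isMarkedK3Hilb_of_marked hM
  -- a polarisation class `h` with `q(h, h) ≠ 0`
  obtain ⟨D⟩ := nonempty_kaehlerRationalDatum hX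
  have hpos := (BBFPositivity.cTrace_pos_and_kaehler_pos hX hM D).2.1
  set h : complexBetti X 2 := D.Hη with hhdef
  have hη : IsPolarizationClass 4 X h := D.isPolarizationClass_Hη hX
  have hh1 : h ∈ algebraicClasses X 1 := hη.mem_algebraicClasses
  set qh : ℂ := k3HilbertForm 2 (φ h) (φ h) with hqhdef
  have hqh : qh ≠ 0 := fun h0 ↦ by rw [h0, Complex.zero_re] at hpos; exact lt_irrefl _ hpos
  -- `B(X)`: `θ = *_L : H⁶ → H²` is `[γ]_*` for an algebraic `γ ∈ N²H⁴(X ⊗ X)`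
  have hab62 : 2 + 2 * 2 + 2 = 2 * 4 := by norm_num
  have hBX := hB.of_squareType hX hK h hη (2 + 2 * 2) 2 hab62
  obtain ⟨c, hab, γ, hγ, hT⟩ := IsAlgebraicCorrespondence.exists_eq_corrAction hX hX hBX
  obtain rfl : c = 2 := by omega
  -- Künneth components of `γ`
  obtain ⟨ρ, hρ, hsum⟩ := exists_sum_kunnethPiece_eq hX hX (2 * 2) γ
  have hρ0 : ρ 0 ∈ algebraicClasses (X ⊗ X) 2 :=
    kunnethComponent_zero_mem_algebraicClasses hcup hX hX hγ hρ hsum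
  have hρ4 := kunnethComponent_last_mem_algebraicClasses hcup hX hX hγ hρ hsum
  -- `b₃ = 0`: the odd components vanish
  haveI : Subsingleton (complexBetti X 3) := by
    haveI := finite_complexBetti hX 3
    exact Module.finrank_zero_iff.1 (hV X hX hK).2.1
  have hρ1 : ρ 1 = 0 := by
    have hmem := mem_kunnethPiece_congr _ (show 3 + 1 = 2 * 2 by norm_num) (by decide) (by decide) (hρ 1)
    rwa [kunnethPiece_eq_bot_of_subsingleton_left, Submodule.mem_bot] at hmem
  have hρ3 : ρ 3 = 0 := by
    have hmem := mem_kunnethPiece_congr _ (show 1 + 3 = 2 * 2 by norm_num) (by decide) (by decide) (hρ 3)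
    rwa [kunnethPiece_eq_bot_of_subsingleton_right, Submodule.mem_bot] at hmem
  -- the middle component `γ₂₂ = ρ 2`: algebraic, in `H² ⊗ H²`, acting as `θ` on `H⁶`
  have h22 : 2 + 2 = 2 * 2 := rfl
  have hρ2mem : ρ 2 ∈ kunnethPiece X X h22 := mem_kunnethPiece_congr _ h22 (by decide) (by decide) (hρ 2)
  have hρ2eq : ρ 2 = γ - ρ 0 - ρ (Fin.last (2 * 2)) := by
    rw [← hsum, Fin.sum_univ_five, hρ1, hρ3, show (Fin.last (2 * 2) : Fin (2 * 2 + 1)) = 4 from by decide]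
    abel
  have hρ2alg : ρ 2 ∈ algebraicClasses (X ⊗ X) 2 :=
    hρ2eq ▸ Submodule.sub_mem _ (Submodule.sub_mem _ hγ hρ0) hρ4
  have hact : corrAction μ hX hX hab (ρ 2) = lefschetzInvolution hη.hasHardLefschetz hab62 := by
    rw [hT, ← hsum]; exact (corrAction_sum_kunnethComponents_of_add_eq μ hX hX hρ hab 2 (by decide)).symm
  -- the scalar `λ` with `pr_{1*} pr₂^* P = λ • 1`
  obtain ⟨lam, hlam⟩ := exists_eq_smul_one μ hX
    (complexGysin μ (hX.tensor_holds hX) hX (fst X X) (show 2 * 4 + 2 * 4 = 0 + 2 * (4 + 4) by omega)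
      (complexBetti.map (snd X X) (2 * 4) P))
  -- the candidate algebraic class `Q' = λq(h,h)·γ₂₂ + (2/(3q(h,h)))·pr₁^*h ∪ pr₂^*h`
  set hh : complexBetti (X ⊗ X) (2 * 2) :=
    cupProduct h22 (complexBetti.map (fst X X) 2 h) (complexBetti.map (snd X X) 2 h) with hhhdef
  have hhhalg : hh ∈ algebraicClasses (X ⊗ X) 2 := by
    simpa using cupProduct_map_fst_map_snd_mem_algebraicClasses hX hX (l := 1) (k := 1) hh1 hh1
  set Q' : complexBetti (X ⊗ X) (2 * 2) := (lam * qh) • ρ 2 + (2 / (3 * qh)) • hh with hQ'def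
  have hQ'alg : Q' ∈ algebraicClasses (X ⊗ X) 2 :=
    Submodule.add_mem _ (Submodule.smul_mem _ _ hρ2alg) (Submodule.smul_mem _ _ hhhalg)
  have hQ'mem : Q' ∈ kunnethPiece X X h22 :=
    Submodule.add_mem _ (Submodule.smul_mem _ _ hρ2mem)
      (Submodule.smul_mem _ _ (cupProduct_fst_snd_mem_kunnethPiece h22 _ _))
  have hQmem : QInv[X, φ] ∈ kunnethPiece X X h22 :=
    Submodule.sum_mem _ fun i _ ↦ Submodule.sum_mem _ fun j _ ↦
      Submodule.smul_mem _ _ (cupProduct_fst_snd_mem_kunnethPiece h22 _ _)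
  suffices hQQ : QInv[X, φ] = Q' by rw [hQQ]; exact hQ'alg
  -- both classes lie in `H² ⊗ H²`: compare their actions on `H⁶ = L_h²(H²)`
  refine eq_of_mem_kunnethPiece_of_corrAction_eq μ hX hX h22 hab62 hab hQmem hQ'mem ?_
  refine LinearMap.ext fun u ↦ ?_
  obtain ⟨a, rfl⟩ := (hη.hasHardLefschetz 2 2 (by norm_num)).2 u
  -- the action of `Q_X`
  have hL : corrAction μ hX hX hab (QInv[X, φ]) (lefschetzPow h 2 2 a) =
      (lam * qh) • a + (2 * lam * k3HilbertForm 2 (φ h) (φ a)) • h := by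
    simp_rw [map_sum, map_smul, LinearMap.sum_apply, LinearMap.smul_apply,
      corrAction_cross_lefschetzPow_two μ hX hMK hab hlam, LinearEquiv.apply_symm_apply, smul_smul]
    have hsplit : ∀ i j : K3HilbertIndex,
        ((((k3HilbertGram 2).map (Int.cast : ℤ → ℂ))⁻¹ i j) *
          (lam * (k3HilbertForm 2 (φ h) (φ h) * k3HilbertForm 2 (φ a) (Pi.single j 1) +
            k3HilbertForm 2 (φ h) (φ a) * k3HilbertForm 2 (φ h) (Pi.single j 1) +
            k3HilbertForm 2 (φ h) (Pi.single j 1) * k3HilbertForm 2 (φ h) (φ a)))) •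
            (LinearEquiv.symm φ) (Pi.single i 1) =
        (lam * qh) • (((((k3HilbertGram 2).map (Int.cast : ℤ → ℂ))⁻¹ i j) *
            k3HilbertForm 2 (φ a) (Pi.single j 1)) • (LinearEquiv.symm φ) (Pi.single i 1)) +
          (2 * lam * k3HilbertForm 2 (φ h) (φ a)) • (((((k3HilbertGram 2).map (Int.cast : ℤ → ℂ))⁻¹ i j) *
            k3HilbertForm 2 (φ h) (Pi.single j 1)) • (LinearEquiv.symm φ) (Pi.single i 1)) := by
      intro i j
      rw [smul_smul, smul_smul, ← add_smul]
      congr 1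
      simp only [hqhdef]
      ring
    rw [Finset.sum_congr rfl fun i _ ↦ Finset.sum_congr rfl fun j _ ↦ hsplit i j]
    simp only [Finset.sum_add_distrib, ← Finset.smul_sum]
    rw [sum_gramInv_mul_k3HilbertForm_smul φ a, sum_gramInv_mul_k3HilbertForm_smul φ h]
  -- the action of `Q'`
  have hR : corrAction μ hX hX hab Q' (lefschetzPow h 2 2 a) =
      (lam * qh) • a + (2 * lam * k3HilbertForm 2 (φ h) (φ a)) • h := by
    rw [hQ'def, map_add, map_smul, map_smul, LinearMap.add_apply, LinearMap.smul_apply,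
      LinearMap.smul_apply, hact, lefschetzInvolution_lefschetzPow hη.hasHardLefschetz (by norm_num) hab62 a,
      hhhdef, corrAction_cross_lefschetzPow_two μ hX hMK hab hlam, smul_smul]
    congr 1
    rw [← hqhdef, k3HilbertForm_comm 2 (φ a) (φ h)]
    field_simp
    ring
  rw [hL, hR]

/-- `Kappa[X, φ]`: VERBATIM the hypothesis shape `hκ` of the tree's `isometrySpannedThird_of_kappaClasses`
(file `…IsometrySpannedThirdKappaClasses`): for every bijective rational Hodge `q`-isometry `g` of `H²(X)` the
class `κ_g = Σᵢⱼ (G⁻¹)ᵢⱼ · φ⁻¹eᵢ ∪ g(φ⁻¹eⱼ)` is algebraic. Local notation only. -/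
local notation3 (prettyPrint := false) "Kappa[" X ", " φ "]" =>
  ∀ g : complexBetti X 2 →ₗ[ℂ] complexBetti X 2, Function.Bijective g →
    (∀ y, IsRationalClass y → IsRationalClass (g y)) →
    (∀ (a b : ℕ) y, IsOfHodgeType 4 X 2 a b y → IsOfHodgeType 4 X 2 a b (g y)) →
    (∀ a b, k3HilbertForm 2 (φ (g a)) (φ (g b)) = k3HilbertForm 2 (φ a) (φ b)) →
    (∑ i : K3HilbertIndex, ∑ j : K3HilbertIndex,
      (((k3HilbertGram 2).map (Int.cast : ℤ → ℂ))⁻¹ i j) •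
        cupProduct (rfl : 2 + 2 = 2 * 2) ((LinearEquiv.symm φ) (Pi.single i 1))
          (g ((LinearEquiv.symm φ) (Pi.single j 1)))) ∈ algebraicClasses X 2

/-- **F-QX universally (the cell Sketch's `QInvAlgebraic` VERBATIM, `qInvClass φ` spelled out): for every
marked smooth projective `K3^{[2]}`-type `X`, `Q_X` is algebraic on `X ⊗ X`**, granted `B(X)` (Charles–Markman)
and `b₃ = 0` (Verbitsky–Guan); i.e. the Sketch's `QInvOfLefschetzStandard` modulo the route's facts
`VerbitskyGuan…` and `Voisin2003_cupProduct_algebraicClasses` (the latter a tree theorem,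
`Theorems.Voisin2003_cupProduct_algebraicClasses_holds`). [cite: CharlesMarkman2013, Thm. 1.1 (§1)]
[cite: Kleiman1968AlgebraicCycles, §2] -/
theorem qInvAlgebraic_of_lefschetzStandard (hV : VerbitskyGuan_cohomology_K3HilbertSquareType)
    (hcup : Voisin2003_cupProduct_algebraicClasses) (hB : CharlesMarkman2013_lefschetzStandard_K3HilbertType) :
    ∀ (X : SchemeOver ℂ), IsSmoothProjective 4 X → IsOfK3HilbertSquareType X →
      ∀ (φ : complexBetti X 2 ≃ₗ[ℂ] (K3HilbertIndex → ℂ)) (P : complexBetti X (2 * 4))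
        (z : K3HilbertIndex → ℂ), MarkedK3Sq[X, φ, P, z] → QInv[X, φ] ∈ algebraicClasses (X ⊗ X) 2 :=
  fun _ hX hK _ _ _ hM ↦ qInv_mem_algebraicClasses hV hcup hB hX hK hM

/-- **Item #3 `IsometrySpannedThird` BY NAME from the route's facts and the implication «`Q_X` algebraic ⇒
`κ_g` algebraic» (W-QX1: `κ_g = pr_{1*}(Q_X ∪ Z_g)`, `Z_g` Markman's class of `g`; hypothesis `hKQ`).**
Composition with `isometrySpannedThird_of_kappaClasses` (`hcup` is discharged in the tree by
`Theorems.Voisin2003_cupProduct_algebraicClasses_holds`). CONDITIONAL; nothing here says HC is proved.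
[cite: Markman2024, §1.1 Thm. 1.1] [cite: CharlesMarkman2013, Thm. 1.1 (§1)] -/
theorem isometrySpannedThird_of_kappaClasses_of_qInv
    (hV : VerbitskyGuan_cohomology_K3HilbertSquareType) (hO : OGrady2008_dualBBFClass_algebraic)
    (hcup : Voisin2003_cupProduct_algebraicClasses) (hB : CharlesMarkman2013_lefschetzStandard_K3HilbertType)
    (hKQ : (∀ (X : SchemeOver ℂ), IsSmoothProjective 4 X → IsOfK3HilbertSquareType X →
        ∀ (φ : complexBetti X 2 ≃ₗ[ℂ] (K3HilbertIndex → ℂ)) (P : complexBetti X (2 * 4))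
          (z : K3HilbertIndex → ℂ), MarkedK3Sq[X, φ, P, z] → QInv[X, φ] ∈ algebraicClasses (X ⊗ X) 2) →
      ∀ (X : SchemeOver ℂ), IsSmoothProjective 4 X → IsOfK3HilbertSquareType X →
        ∀ (φ : complexBetti X 2 ≃ₗ[ℂ] (K3HilbertIndex → ℂ)) (P : complexBetti X (2 * 4))
          (z : K3HilbertIndex → ℂ), MarkedK3Sq[X, φ, P, z] → Kappa[X, φ]) :
    Summit.HodgeConjecture.HodgeConjecture.Theses.MarkmanPartnerTransport.IsometrySpannedThird :=
  isometrySpannedThird_of_kappaClasses hV hO hcup (hKQ (qInvAlgebraic_of_lefschetzStandard hV hcup hB))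

end Marked


end Summit.HodgeConjecture.HodgeConjecture.Theorems.MarkmanPartnerTransport.PartnerLattice

end
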